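import Summits.AtomisticToContinuum.HydrodynamicLimit.Theorems.MourreKoopmanChargesLinearToEntropyInBandGalileanRungPrep
import HarnessLib

/-!
# `OneBodyCompleteness` at every drift: the Galilean rung of the crux `LinearToEntropyInBand`
# (stmt-AtomisticToContinuum-17740), route `MourreKoopmanCharges`

Support file 2/2 (`--supports stmt-AtomisticToContinuum-17740`, registered stub
`stub_oneBodyCompletenessGalilean`) of the line `registered`, skeleton v5
(`Cruxes/LinearToEntropyInBand/Lines/birth.lean`); file 1/2 is
`Theorems/MourreKoopmanChargesLinearToEntropyInBandGalileanRungPrep.lean` (tools, Maxwellian orthogonality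
covariance `orth_translate`, boost kinematics of the one-body field, the statics cost of a moving test function
`succ_mul_abs_corr_sub_le`, Cesàro means of nearby kernels `cesaro_abs_le_of_near`).

The route's typed Mourre output `MourreKoopmanCharges.OneBodyCompleteness` (stmt-9583) is the Cesàro decay
of the rescaled two-time correlation `(N+1) · E_{G_0}[A_h(χ)(Φ_t z) A_h(χ)(z)]` of the one-body empirical
field `A_h(χ)(z) = (N+1)⁻¹ Σᵢ χ(xᵢ) h(vᵢ)` under the homogeneous canonical law `G_0 = localGibbsLaw σ 1 0 θ`
AT DRIFT `u = 0`, for `h ⊥ {1, v, |v|²}` in `L²(M_θ)`; visible flux-Gibbsianity (stub 1 of the line)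
quantifies over all drifts. This rung transports the hypothesis to the law `G_u = localGibbsLaw σ 1 u θ`
with an arbitrary drift `u ∈ ℝ³` by the Galilean boost, everything being landed:

* statics of the boost: `G_u = (velShift u)_# G_0` (`KineticWindowGronwallBoost.localGibbsLaw_const_map_velShift`),
  and `M_{θ,u}`-orthogonality of `h` to `1, vᵢ, |v|²` is `M_{θ,0}`-orthogonality of `g = h(· + u)`
  (`orth_translate`, translation of the Gaussian velocity law);
* dynamics of the boost: for every flow `Φ` and `G_0`-a.e. `w`, `Φ_t(velShift u w) = boostAt u t (Ψ_t w)`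
  for all `t ≥ 0`, `Ψ = boostReg … (-u)` the rest-frame hard-sphere flow
  (`KineticWindowGronwallBoost.ae_flow_boostAt_eq_of_absolutelyContinuous`), whence the IDENTITY
  `E_{G_u}[A_h(χ)(Φ_t z) A_h(χ)(z)] = E_{G_0}[A_g(χ_t)(Ψ_t w) A_g(χ)(w)]`, `χ_t = χ(· + t u)`
  (`corr_eq_corr_boostReg`);
* the moving test function costs `(N+1)|E_{G_0}[A_g(χ_t − χ)(Ψ_t w) A_g(χ)(w)]| ≤ ‖χ_t − χ‖_{L²} ‖χ‖_{L²} ∫ g² M_θ`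
  (Cauchy–Schwarz, stationarity, and the exact statics `torusStaticVariance`), which is small on the
  Euler window `t = s(N+1)^{-1/3} ≤ S(N+1)^{-1/3} → 0` by uniform continuity of `χ` on `𝕋³`;
* Cesàro assembly: `OneBodyCompleteness` for `(g, Ψ, χ)` at tolerance `δ/2` plus the uniform error `δ/2`.

References: H. Spohn, *Large Scale Dynamics of Interacting Particles* (1991), Part I §2.3 (Galilean
invariance of the local equilibrium states) and §7.1; folklore otherwise.
-/

noncomputable section

namespace Summit.AtomisticToContinuum.HydrodynamicLimit.Theorems.LTEInBand

open MeasureTheory ProbabilityTheory Filter Topology Set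
open Literature.Analysis.FluidPDE Literature.MathematicalPhysics.KineticTheory
open Literature.Analysis.FunctionSpaces
open scoped InnerProductSpace ENNReal BigOperators Interval
open Summit.AtomisticToContinuum.HydrodynamicLimit.Theorems
open MourreKoopmanChargesIdealGasNoDecay MourreKoopmanChargesOneBodyCompleteness KineticWindowGronwallBoost
  EquilibriumStressVarianceDecayC3 BoltzmannGreenKuboOrthMomentum
open Summit.AtomisticToContinuum.HydrodynamicLimit.Theses

/-! ### § 1 The boost identity for the two-time correlation -/

section Identity

/-- **Galilean covariance of the two-time correlation.** For every flow `Φ`, drift `u`, `t ≥ 0` and `θ > 0`: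
`E_{G_u}[A_h(χ)(Φ_t z) A_h(χ)(z)] = E_{G_0}[A_g(χ_t)(Ψ_t w) A_g(χ)(w)]` with `g = h(· + u)`,
`χ_t = χ(· + proj(t u))`, `Ψ = boostReg … (-u)` the rest-frame hard-sphere flow, `G_u = localGibbsLaw σ 1 u θ N Φ`
and `G_0 = localGibbsLaw σ 1 0 θ N Ψ` (`G_u = (velShift u)_# G_0`, the a.e. boost dictionary, and the
kinematics of the empirical field). [folklore] -/
theorem corr_eq_corr_boostReg {σ θ : ℝ} (hθ : 0 < θ) (u : V3) (χ : T3 → ℝ) (h : V3 → ℝ) (N : ℕ)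
    (hε : 0 < hsDiameter σ N) (hε' : hsDiameter σ N < 2⁻¹)
    (Φ Ψ : HardSphereFlow (Torus.geometry (Fin 3)) (hsDiameter σ N) (N + 1))
    (hΨ : Ψ = boostReg hε hε' (N + 1) (-u)) {t : ℝ} (ht : 0 ≤ t) :
    ∫ z, (∫ y, χ y.1 * h y.2 ∂(empiricalMeasure (Φ.flow t z))) * (∫ y, χ y.1 * h y.2 ∂(empiricalMeasure z))
        ∂(localGibbsLaw σ (fun _ => 1) (fun _ => u) (fun _ => θ) N Φ) =
      ∫ w, (∫ y, χ (y.1 + Torus.proj (t • u)) * h (y.2 + u) ∂(empiricalMeasure (Ψ.flow t w))) *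
        (∫ y, χ y.1 * h (y.2 + u) ∂(empiricalMeasure w))
        ∂(localGibbsLaw σ (fun _ => 1) (fun _ => 0) (fun _ => θ) N Ψ) := by
  subst hΨ
  have hmap := integral_localGibbsLaw_velShift σ 1 hθ 0 u N (boostReg hε hε' (N + 1) (-u)) Φ
    (fun z => (∫ y, χ y.1 * h y.2 ∂(empiricalMeasure (Φ.flow t z))) *
      (∫ y, χ y.1 * h y.2 ∂(empiricalMeasure z)))
  rw [zero_add] at hmap
  rw [hmap]
  refine integral_congr_ae ?_
  filter_upwards [ae_flow_boostAt_eq_of_absolutelyContinuous hε hε' Φ u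
    (localGibbsLaw_absolutelyContinuous σ (fun _ => 1) (fun _ => 0) (fun _ => θ) N
      (boostReg hε hε' (N + 1) (-u)))] with w hw
  rw [velShift_eq_boostAt_zero, hw t ht, oneBodyField_boostAt χ h u t, oneBodyField_boostAt χ h u 0]
  simp only [zero_smul, Torus.proj_zero, add_zero]

end Identity

/-! ### § 2 The registered stub -/

section Rung

/-- **Registered stub `stub_oneBodyCompletenessGalilean` of crux stmt-AtomisticToContinuum-17740 — THE
GALILEAN RUNG: `OneBodyCompleteness` (stmt-9583, drift `0`) implies the same Cesàro decay of the rescaled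
two-time correlation `(N+1) · E_{G_u}[A_h(χ)(Φ_{s(N+1)^{-1/3}} z) A_h(χ)(z)]` under the homogeneous canonical
law `G_u = localGibbsLaw σ 1 u θ` with EVERY drift `u ∈ ℝ³`, for `h ⊥ {1, v, |v|²}` in `L²(M_{θ,u})`, every
flow family, every continuous `χ` and `σ < min σ₀ ½`.**  Boost identity (§ 1) + the cost of the moving test
function `χ(· + t u)` on the Euler window (file 1/2, uniform continuity of `χ`, `t ≤ S(N+1)^{-1/3} → 0`) + the
hypothesis in the rest frame for `(h(· + u), boostReg … (-u), χ)` at tolerance `δ/2`. [folklore] -/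
theorem stub_oneBodyCompletenessGalilean : Summit.AtomisticToContinuum.HydrodynamicLimit.Theses.MourreKoopmanCharges.OneBodyCompleteness → ∃ σ₀ : ℝ, 0 < σ₀ ∧ ∀ σ : ℝ, 0 < σ → σ < σ₀ → ∀ θ : ℝ, 0 < θ → ∀ u : Literature.MathematicalPhysics.KineticTheory.V3, ∀ h : Literature.MathematicalPhysics.KineticTheory.V3 → ℝ, Continuous h → (∃ (C : ℝ) (k : ℕ), ∀ v, |h v| ≤ C * (1 + ‖v‖) ^ k) → (∫ v, h v * Literature.Analysis.FluidPDE.localMaxwellian 1 θ u v = 0) → (∀ i : Fin 3, ∫ v, h v * v i * Literature.Analysis.FluidPDE.localMaxwellian 1 θ u v = 0) → (∫ v, h v * ‖v‖ ^ 2 * Literature.Analysis.FluidPDE.localMaxwellian 1 θ u v = 0) → ∀ Φ : (N : ℕ) → Literature.Analysis.FluidPDE.HardSphereFlow (Literature.Analysis.FluidPDE.Torus.geometry (Fin 3)) (Literature.MathematicalPhysics.KineticTheory.hsDiameter σ N) (N + 1), ∀ χ : Literature.MathematicalPhysics.KineticTheory.T3 → ℝ, Continuous χ → ∀ δ : ℝ,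 0 < δ → ∃ S₀ : ℝ, 0 < S₀ ∧ ∀ S : ℝ, S₀ ≤ S → ∃ N₀ : ℕ, ∀ N : ℕ, N₀ ≤ N → |S⁻¹ * ∫ s in (0 : ℝ)..S, ((N : ℝ) + 1) * ∫ z, (∫ y, χ y.1 * h y.2 ∂(Literature.Analysis.FluidPDE.empiricalMeasure ((Φ N).flow (s * ((N : ℝ) + 1) ^ (-(1 / 3 : ℝ))) z))) * (∫ y, χ y.1 * h y.2 ∂(Literature.Analysis.FluidPDE.empiricalMeasure z)) ∂(Literature.MathematicalPhysics.KineticTheory.localGibbsLaw σ (fun _ => 1) (fun _ => u) (fun _ => θ) N (Φ N))| ≤ δ := by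
  intro hA
  obtain ⟨σ₀, hσ₀, HA⟩ := hA
  refine ⟨min σ₀ (1 / 2), lt_min hσ₀ (by norm_num), ?_⟩
  intro σ hσ hσlt θ hθ u h hh hpoly h1 h2 h3 Φ χ hχ δ hδ
  have hσ₀' : σ < σ₀ := lt_of_lt_of_le hσlt (min_le_left _ _)
  have hσ2 : σ < 1 / 2 := lt_of_lt_of_le hσlt (min_le_right _ _)
  obtain ⟨C, k, hCk⟩ := hpoly
  -- (1) the translated velocity profile `g = h(· + u)`
  have hg : Continuous fun v => h (v + u) := hh.comp (continuous_id.add continuous_const)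
  have hgCk : ∀ v, |h (v + u)| ≤ |C| * (1 + ‖u‖) ^ k * (1 + ‖v‖) ^ k := poly_growth_translate hCk u
  have hgpoly : ∃ (C' : ℝ) (k' : ℕ), ∀ v, |h (v + u)| ≤ C' * (1 + ‖v‖) ^ k' := ⟨_, k, hgCk⟩
  obtain ⟨hg1, hg2, hg3⟩ := orth_translate hθ u hh hCk h1 h2 h3
  -- (2) the rest-frame flow family `N ↦ boostReg … (-u)`
  have hε : ∀ N, 0 < hsDiameter σ N := fun N => hsDiameter_pos hσ N
  have hε' : ∀ N, hsDiameter σ N < 2⁻¹ := fun N =>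
    (hsDiameter_le hσ.le N).trans_lt (by rw [inv_eq_one_div]; exact hσ2)
  -- (3) `OneBodyCompleteness` in the rest frame at tolerance `δ/2`
  obtain ⟨S₀, hS₀, HS⟩ := HA σ hσ hσ₀' θ hθ (fun v => h (v + u)) hg hgpoly hg1 hg2 hg3
    (fun N => boostReg (hε N) (hε' N) (N + 1) (-u)) χ hχ (δ / 2) (half_pos hδ)
  refine ⟨S₀, hS₀, fun S hS => ?_⟩
  obtain ⟨N₀, hN₀⟩ := HS S hS
  have hSpos : 0 < S := hS₀.trans_le hS
  -- constants of the error budget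
  obtain ⟨M₂, hM₂⟩ : ∃ M : ℝ, M = ∫ v, h (v + u) ^ 2 * localMaxwellian 1 θ (0 : V3) v := ⟨_, rfl⟩
  obtain ⟨Vχ, hVχ⟩ : ∃ V : ℝ, V = ∫ x, χ x * χ x := ⟨_, rfl⟩
  have hM₂0 : 0 ≤ M₂ := by
    rw [hM₂]
    exact integral_nonneg fun v => mul_nonneg (sq_nonneg _) (localMaxwellian_nonneg zero_le_one hθ.le _ _)
  obtain ⟨K, hK⟩ : ∃ K : ℝ, K = Real.sqrt M₂ * Real.sqrt (Vχ * M₂) := ⟨_, rfl⟩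
  have hK0 : 0 ≤ K := by
    rw [hK]
    exact mul_nonneg (Real.sqrt_nonneg _) (Real.sqrt_nonneg _)
  obtain ⟨ε₁, hε₁⟩ : ∃ ε : ℝ, ε = δ / (2 * (K + 1)) := ⟨_, rfl⟩
  have hε₁0 : 0 < ε₁ := by rw [hε₁]; positivity
  have hε₁K : ε₁ * K ≤ δ / 2 := by
    rw [hε₁, div_mul_eq_mul_div, div_le_div_iff₀ (by positivity) (by positivity)]
    nlinarith [hK0, hδ]
  -- (6) uniform continuity of `χ` and the Euler-window threshold `N₁`
  obtain ⟨τ, hτ, hτχ⟩ := exists_translate_bound hχ hε₁0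
  obtain ⟨N₁, hN₁⟩ : ∃ N₁ : ℕ, ∀ N ≥ N₁, S * ((N : ℝ) + 1) ^ (-(1 / 3 : ℝ)) * ‖u‖ < τ := by
    have ht1 : Tendsto (fun N : ℕ => (N : ℝ) + 1) atTop atTop :=
      tendsto_atTop_add_const_right _ _ tendsto_natCast_atTop_atTop
    have ht2 := (((tendsto_rpow_neg_atTop (by norm_num : (0 : ℝ) < 1 / 3)).comp ht1).const_mul S).mul_const
      ‖u‖
    rw [mul_zero, zero_mul] at ht2
    exact eventually_atTop.1 (ht2.eventually (gt_mem_nhds hτ))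
  refine ⟨max N₀ N₁, fun N hN => ?_⟩
  have hNN₀ : N₀ ≤ N := (le_max_left _ _).trans hN
  have hNN₁ : N₁ ≤ N := (le_max_right _ _).trans hN
  -- notation at this `N`: the Euler time unit `c`, the rest-frame flow `Ψ`
  have hNpos : (0 : ℝ) < (N : ℝ) + 1 := by positivity
  obtain ⟨c, hc⟩ : ∃ c : ℝ, c = ((N : ℝ) + 1) ^ (-(1 / 3 : ℝ)) := ⟨_, rfl⟩
  have hcpos : 0 < c := by
    rw [hc]
    exact Real.rpow_pos_of_pos hNpos _
  have hcu : S * c * ‖u‖ < τ := by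
    rw [hc]
    exact hN₁ N hNN₁
  obtain ⟨Ψ, hΨ⟩ : ∃ Ψ : HardSphereFlow (Torus.geometry (Fin 3)) (hsDiameter σ N) (N + 1),
      Ψ = boostReg (hε N) (hε' N) (N + 1) (-u) := ⟨_, rfl⟩
  haveI : IsProbabilityMeasure (localGibbsLaw σ (fun _ => 1) (fun _ => 0) (fun _ => θ) N Ψ) :=
    isProbabilityMeasure_localGibbsLaw_const hθ hσ2.le 0 N Ψ
  have hAm : Measurable fun w : Config (N + 1) (Fin 3) T3 => ∫ y, χ y.1 * h (y.2 + u) ∂(empiricalMeasure w) :=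
    measurable_oneBodyField hχ hg
  have hA2 := memLp_two_oneBodyField_localGibbsLaw_one hθ hσ2.le N Ψ hχ hg hgCk
  -- the rest-frame bound, at this `N`
  have h0 := hN₀ N hNN₀
  rw [← hc, ← hΨ] at h0
  rw [← hc]
  -- the rest-frame kernel is interval integrable
  have hF₀i := intervalIntegrable_scaled_corr (measurable_corr 1 θ (0 : V3) Ψ hAm)
    (fun t => abs_corr_le_integral_sq 1 θ (0 : V3) Ψ hAm hA2 t) ((N : ℝ) + 1) c 0 S
  -- the uniform error on the Euler window
  have hdiff : ∀ s ∈ Ι (0 : ℝ) S,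
      |((N : ℝ) + 1) * (∫ z, (∫ y, χ y.1 * h y.2 ∂(empiricalMeasure ((Φ N).flow (s * c) z))) *
          (∫ y, χ y.1 * h y.2 ∂(empiricalMeasure z))
          ∂(localGibbsLaw σ (fun _ => 1) (fun _ => u) (fun _ => θ) N (Φ N))) -
        ((N : ℝ) + 1) * ∫ w, (∫ y, χ y.1 * h (y.2 + u) ∂(empiricalMeasure (Ψ.flow (s * c) w))) *
          (∫ y, χ y.1 * h (y.2 + u) ∂(empiricalMeasure w))
          ∂(localGibbsLaw σ (fun _ => 1) (fun _ => 0) (fun _ => θ) N Ψ)| ≤ δ / 2 := by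
    intro s hs
    rw [uIoc_of_le hSpos.le] at hs
    have ht0 : 0 ≤ s * c := (mul_pos hs.1 hcpos).le
    have htu : ‖(s * c) • u‖ < τ := by
      rw [norm_smul, Real.norm_eq_abs, abs_of_nonneg ht0]
      calc s * c * ‖u‖ ≤ S * c * ‖u‖ :=
            mul_le_mul_of_nonneg_right (mul_le_mul_of_nonneg_right hs.2 hcpos.le) (norm_nonneg u)
        _ < τ := hcu
    have hχt : ∀ x, |χ (x + Torus.proj ((s * c) • u)) - χ x| ≤ ε₁ := hτχ _ htu
    have hχtc : Continuous fun x => χ (x + Torus.proj ((s * c) • u)) :=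
      hχ.comp (continuous_id.add continuous_const)
    have hI : ∫ x, (χ (x + Torus.proj ((s * c) • u)) - χ x) * (χ (x + Torus.proj ((s * c) • u)) - χ x) ≤
        ε₁ * ε₁ := by
      calc ∫ x, (χ (x + Torus.proj ((s * c) • u)) - χ x) * (χ (x + Torus.proj ((s * c) • u)) - χ x)
          ≤ ∫ _ : T3, ε₁ * ε₁ :=
            integral_mono_of_nonneg (Eventually.of_forall fun x => mul_self_nonneg _) (integrable_const _)
              (Eventually.of_forall fun x => by
                show (χ (x + Torus.proj ((s * c) • u)) - χ x) * (χ (x + Torus.proj ((s * c) • u)) - χ x) ≤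
                  ε₁ * ε₁
                rw [← abs_mul_abs_self (χ (x + Torus.proj ((s * c) • u)) - χ x)]
                exact mul_self_le_mul_self (abs_nonneg _) (hχt x))
        _ = ε₁ * ε₁ := by rw [integral_const, probReal_univ, one_smul]
    have hb := succ_mul_abs_corr_sub_le hσ hσ2 hθ hg hgCk hg1 N Ψ hχtc hχ (s * c)
    rw [← hM₂, ← hVχ] at hb
    rw [corr_eq_corr_boostReg hθ u χ h N (hε N) (hε' N) (Φ N) Ψ hΨ ht0, ← mul_sub, abs_mul, abs_of_pos hNpos]
    calc _ ≤ Real.sqrt ((∫ x, (χ (x + Torus.proj ((s * c) • u)) - χ x) *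
              (χ (x + Torus.proj ((s * c) • u)) - χ x)) * M₂) * Real.sqrt (Vχ * M₂) := hb
      _ ≤ Real.sqrt (ε₁ * ε₁ * M₂) * Real.sqrt (Vχ * M₂) :=
          mul_le_mul_of_nonneg_right (Real.sqrt_le_sqrt (mul_le_mul_of_nonneg_right hI hM₂0))
            (Real.sqrt_nonneg _)
      _ = ε₁ * K := by
          rw [Real.sqrt_mul (mul_self_nonneg ε₁), Real.sqrt_mul_self hε₁0.le, hK, mul_assoc]
      _ ≤ δ / 2 := hε₁K
  -- (7) Cesàro assembly
  exact cesaro_abs_le_of_near hSpos hδ hF₀i h0 hdiff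

end Rung

end Summit.AtomisticToContinuum.HydrodynamicLimit.Theorems.LTEInBand

end
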